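import Summits.ResolutionOfSingularities.ResolutionOfSingularities.Theorems.WildConesCampaignW46HypersurfacesCharTwoDescentOffChart
import Summits.ResolutionOfSingularities.ResolutionOfSingularities.Theorems.WildConesCampaignW46HypersurfacesCharTwoNearPoint

/-!
# [OURS · L1 W4.6, rung (ii) at p = 2, EVERY dimension n] EXISTENCE OF THE INFINITELY-NEAR DOUBLE POINT:
# an isolated double point with curvilinear Milnor algebra (`e = 1`) has a double successor IFF `μ ≥ 4`,
# and is resolved by ONE blow-up IFF `μ = 2` — `z² = a(u₁,…,uₙ)`, `n ≥ 3`, every field of char 2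

HONEST FRAMING. Everything here is OURS: theorems about route WildCones' own TYPED point-blow-up dynamics
(`Theorems/WildConesClassicalRegimesDefs.lean`: `step i τ c` = blow up the point, chart `u_i`, translate
by `τ`, delete squares; `MultP`, `OrdP`, `Isol`, `mu`) and the seat's invariants `milnorEmbDim` (p498937)
and `polarMatrix` (p502936). It completes, in every dimension `n ≥ 3`, the picture the seat's gen 2 proved
for threefolds (`…ThreefoldsCharTwoNearPointExists.lean`, p481532): with closure
(`hypersurface_regime_step`, p501990), uniqueness (`hypersurface_nearPoint_unique'`, p503790) and the
present existence theorem, the infinitely-near double points above an isolated double point with `e = 1`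
form ONE CHAIN of length exactly `μ/2 − 1` (every branch is smooth after at most `μ/2` blow-ups,
`hypersurface_smooth_le_half`). NOTHING here is a statement of the manuscript [Hironaka2017]; no FACT-LIST
premise; AI review is weaker than expert review. Cell res-hironaka (LADDER-RESOLUTION rung L, D-0089), slot
W4.6, seat res-L1-s46-pv-4 (gen 3); host route `WildCones`, crux `ClassicalRegimes`
(stmt-ResolutionOfSingularities-16884; proved).

WHAT IS PROVED (every `n`, every field of characteristic `2`):

* `coeff_single_serT_eq_vecMul` — off the chart index the linear coefficients of the strict transform
  ARE the near vector applied to the polar matrix: `[u_m] T = (w·P)_m`, `w = (τ with w_i = 1)`.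
* `hypersurface_mu_eq_two_of_chart_linear` — `e ≤ 1`, isolated, `w ∈ ker P`, `[u_i] T ≠ 0 ⇒ μ = 2`
  (`∂_i T` is a unit; `formal_drop_offChart`).
* `hypersurface_exists_double_successor` — `n ≥ 3`, `e = 1`, isolated, `μ ≥ 4 ⇒` a DOUBLE successor
  exists (chart of a non-zero coordinate of the kernel vector, pinned translation);
  `hypersurface_exists_double_successor_iff_four_le_mu`; `hypersurface_resolved_in_one_iff_mu_eq_two`.
  They replace the role of the EXISTENCE of the next centre of the iterated procedure (Th. 16.6 p.84
  L4–L6; §16.3 p.87 L14–L16) in this regime, with OUR number — NOT a statement of the manuscript.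

References: G.-M. Greuel, G. Pfister, J. Algebra 689 (2026) [GreuelPfister2026] (through the tree's
`pair_reduction`); H. Hironaka, ms. 2017 [Hironaka2017] Th. 16.6 p.84, Th. 16.13 p.87 — role replaced only.
-/

noncomputable section

-- single-problem summit: the doubled namespace component `ResolutionOfSingularities` is forced
set_option linter.dupNamespace false

open scoped BigOperators Classical

open MvPowerSeries IsLocalRing

open Literature.AlgebraicGeometry.Resolution

namespace Summit.ResolutionOfSingularities.ResolutionOfSingularities.Theorems

namespace CampaignW46.HypersurfacesCharTwo

open WildCones WildCones.MuDropCharTwoOrdP ThreefoldsCharTwo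

variable {κ : Type} [Field κ] {n : ℕ}

/-! ## The pinned translation: existence of the near double point -/

/-- [OURS · L1 W4.6] **Off the chart index, the linear coefficients of the strict transform are the
near vector applied to the polar matrix**: `[u_m] T = (w · P)_m` for `m ≠ i`, `w = (τ with w_i = 1)`
(`coeff_single_strict`, rearranged; no hypothesis on the successor). [folklore] -/
theorem coeff_single_serT_eq_vecMul [CharP κ 2] (c : (Fin n → ℕ) → κ) (i : Fin n) (τ : Fin n → κ)
    (hM : MultP 2 n κ c) {m : Fin n} (hm : m ≠ i) :
    coeff (Finsupp.single m 1) (show MvPowerSeries (Fin n) κ from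
        fun A : Fin n →₀ ℕ => tr n κ i τ 2 (dv n κ i 2 (bl n κ i (clean 2 n κ c))) ⇑A) =
      Matrix.vecMul (Function.update τ i 1) (polarMatrix (ser 2 n κ c)) m := by
  rw [coeff_single_strict i τ (two_le_order_ser hM) (X_pow_mul_serT_eq_subst c i τ hM) hm]
  simp only [Matrix.vecMul, dotProduct]
  rw [← Finset.add_sum_erase _ _ (Finset.mem_univ i), Function.update_self, one_mul]
  congr 1
  · simp [polarMatrix, Ne.symm hm]
  · refine Finset.sum_congr rfl fun s hs => ?_
    have hsi : s ≠ i := Finset.ne_of_mem_erase hs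
    rw [Function.update_of_ne hsi]
    by_cases hsm : s = m
    · subst hsm
      have h2 : (((Finsupp.single s 1 : Fin n →₀ ℕ) s : ℕ) : κ) + 1 = 0 := by
        rw [Finsupp.single_eq_same, Nat.cast_one]
        exact CharTwo.add_self_eq_zero 1
      rw [h2, mul_zero, zero_mul, polarMatrix_diag, mul_zero]
    · have h2 : (((Finsupp.single s 1 : Fin n →₀ ℕ) m : ℕ) : κ) + 1 = 1 := by
        rw [Finsupp.single_apply, if_neg hsm, Nat.cast_zero, zero_add]
      rw [h2, mul_one]
      simp only [polarMatrix, Matrix.of_apply, if_neg hsm]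

/-- [OURS · L1 W4.6 rung (ii) at `p = 2`, every dimension; NOT a statement of the manuscript] **A
NON-ZERO CHART-LINEAR COEFFICIENT AT A KERNEL TRANSLATION FORCES `μ = 2`** (`z² = a(u₁,…,uₙ)`, any
field of characteristic `2`): let `c` be an isolated double state with `e(c) ≤ 1` and `τ` a translation
in chart `i` whose near vector lies in the kernel of the polar form (so `[u_m] T = 0` off `i`,
`coeff_single_serT_eq_vecMul`); if `[u_i] T ≠ 0` then `μ(c) = 2`: `∂_i T` is a unit, the Milnor
algebra of `T` is `0`, and `formal_drop_offChart` gives `μ = 0 + 2`. (`n = 3`: gen 2's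
`threefold_mu_eq_two_of_chart_linear`.) [cite: GreuelPfister2026, Thm 3.5 and Cor 3.7] -/
theorem hypersurface_mu_eq_two_of_chart_linear [CharP κ 2] (c : (Fin n → ℕ) → κ) (i : Fin n)
    (τ : Fin n → κ) (hM : MultP 2 n κ c) (hI : Isol 2 n κ c) (he : milnorEmbDim 2 n κ c ≤ 1)
    (hker : Matrix.vecMul (Function.update τ i 1) (polarMatrix (ser 2 n κ c)) = 0)
    (hTi : coeff (Finsupp.single i 1) (show MvPowerSeries (Fin n) κ from
      fun A : Fin n →₀ ℕ => tr n κ i τ 2 (dv n κ i 2 (bl n κ i (clean 2 n κ c))) ⇑A) ≠ 0) :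
    mu 2 n κ c = 2 := by
  set T : MvPowerSeries (Fin n) κ := (show MvPowerSeries (Fin n) κ from
      fun A : Fin n →₀ ℕ => tr n κ i τ 2 (dv n κ i 2 (bl n κ i (clean 2 n κ c))) ⇑A) with hT
  have hoff : ∀ m, m ≠ i → coeff (Finsupp.single m 1) T = 0 := by
    intro m hm
    rw [hT, coeff_single_serT_eq_vecMul c i τ hM hm, hker, Pi.zero_apply]
  have hcol := (milnorEmbDim_le_and_mod_two hM).2.2
  obtain ⟨-, hdrop⟩ := formal_drop_offChart n i τ (ser 2 n κ c) T (two_le_order_ser hM) hoff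
    (X_pow_mul_serT_eq_subst c i τ hM) (by omega) ((isol_iff_finite_pderiv c).mp hI)
  -- the Milnor algebra of `T` vanishes: `∂_i T` is a unit
  have hunit : IsUnit (MvPowerSeries.pderiv i T) := by
    rw [MvPowerSeries.isUnit_iff_constantCoeff, constantCoeff_pderiv]
    exact isUnit_iff_ne_zero.mpr hTi
  have htop : Ideal.span (Set.range fun s => MvPowerSeries.pderiv s T) = ⊤ :=
    Ideal.eq_top_of_isUnit_mem _ (Ideal.subset_span ⟨i, rfl⟩) hunit
  haveI : Subsingleton (MvPowerSeries (Fin n) κ ⧸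
      Ideal.span (Set.range fun s => MvPowerSeries.pderiv s T)) :=
    Ideal.Quotient.subsingleton_iff.mpr htop
  rw [Module.finrank_zero_of_subsingleton, zero_add] at hdrop
  rw [mu_eq_finrank_pderiv]
  exact hdrop.symm

/-- [OURS · L1 W4.6 rung (ii) at `p = 2`, every dimension; NOT a statement of the manuscript] **`μ ≥ 4`
⇒ AN INFINITELY-NEAR DOUBLE POINT EXISTS** (`z² = a(u₁,…,uₙ)`, `n ≥ 3`, any field of characteristic
`2`): an isolated double state with `e(c) = 1` (polar form of corank one) and Milnor number `≥ 4` has a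
DOUBLE point among its point-blow-up successors — in a chart `i` where the kernel vector `w` of the polar
form has `w_i ≠ 0`, at the PINNED translation `τ = w/w_i`. By `hypersurface_regime_step` it is again in
the regime with `μ − 2`, and by `hypersurface_nearPoint_unique'` it is the only one. (`n = 3`: gen 2's
`threefold_exists_double_successor_of_four_le_mu`.) [cite: GreuelPfister2026, Thm 3.5 and Cor 3.7] -/
theorem hypersurface_exists_double_successor [CharP κ 2] (hn : 3 ≤ n) (c : (Fin n → ℕ) → κ)
    (hM : MultP 2 n κ c) (hI : Isol 2 n κ c) (he : milnorEmbDim 2 n κ c = 1) (hμ : 4 ≤ mu 2 n κ c) :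
    ∃ (i : Fin n) (τ : Fin n → κ), MultP 2 n κ (step 2 n κ i τ c) := by
  set P := polarMatrix (ser 2 n κ c) with hP
  -- a non-zero kernel vector
  have hfr : Module.finrank κ (LinearMap.ker P.mulVecLin) = 1 := by
    rw [hP, finrank_ker_polarMatrix hM, he]
  obtain ⟨w, hwK, hw0⟩ : ∃ w ∈ LinearMap.ker P.mulVecLin, w ≠ 0 := by
    by_contra h
    push Not at h
    have hbot : LinearMap.ker P.mulVecLin = ⊥ := by
      rw [Submodule.eq_bot_iff]
      exact h
    rw [hbot, finrank_bot] at hfr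
    exact zero_ne_one hfr
  obtain ⟨i, hi⟩ : ∃ i, w i ≠ 0 := by
    by_contra h
    push Not at h
    exact hw0 (funext h)
  -- the pinned translation
  set τ : Fin n → κ := fun s => (w i)⁻¹ * w s with hτ
  have hupd : Function.update τ i 1 = (w i)⁻¹ • w := by
    funext s
    by_cases hs : s = i
    · rw [hs, Function.update_self, Pi.smul_apply, smul_eq_mul, inv_mul_cancel₀ hi]
    · rw [Function.update_of_ne hs, Pi.smul_apply, smul_eq_mul]
  have hker : Matrix.vecMul (Function.update τ i 1) P = 0 := by
    rw [hupd, Matrix.smul_vecMul, (mem_ker_polarMatrix_iff _ _).mp hwK, smul_zero]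
  refine ⟨i, τ, ?_⟩
  by_contra hM'
  -- the successor is non-zero and not a double point: it has a linear cleaned monomial `u_m`
  have hO : OrdP 2 n κ c := by
    rw [ordP_iff_milnorEmbDim_add_two_le hM]
    omega
  obtain ⟨A, hA, hdeg⟩ := exists_linear_of_not_multP (ser_step_ne_zero_of_ordP c i τ hM hO) hM'
  have hdeg' : (Finsupp.equivFunOnFinite.symm A).degree = 1 := by
    rw [Finsupp.degree_eq_sum]
    exact hdeg
  obtain ⟨m, hm⟩ := exists_eq_single_of_degree_eq_one hdeg'
  have hAm : A = ⇑(Finsupp.single m 1 : Fin n →₀ ℕ) := by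
    rw [← hm]
    rfl
  have hlin : coeff (Finsupp.single m 1) (show MvPowerSeries (Fin n) κ from
      fun A : Fin n →₀ ℕ => tr n κ i τ 2 (dv n κ i 2 (bl n κ i (clean 2 n κ c))) ⇑A) ≠ 0 := by
    have hm1 : ¬ 2 ∣ (⇑(Finsupp.single m 1 : Fin n →₀ ℕ)) m := by simp
    have h := hA
    rw [hAm, OrdPExitSurface.step_eq i τ hM, CaseAExitOrdSucc.clean_clean,
      OrdPExitSurface.clean_apply_of_not_dvd _ _ m hm1] at h
    exact h
  -- off the chart the linear coefficients vanish (kernel), so `m = i`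
  have hmi : m = i := by
    by_contra hmi
    apply hlin
    rw [coeff_single_serT_eq_vecMul c i τ hM hmi, hker, Pi.zero_apply]
  subst hmi
  -- hence `μ = 2`, contradicting `μ ≥ 4`
  have h2 := hypersurface_mu_eq_two_of_chart_linear c m τ hM hI (by omega) hker hlin
  omega

/-- [OURS · L1 W4.6 rung (ii) at `p = 2`, every dimension; NOT a statement of the manuscript] **An
isolated double point with curvilinear Milnor algebra (`e = 1`) has an infinitely-near double point IFF
`μ ≥ 4`** (`n ≥ 3`, any field of characteristic `2`; `→` is `hypersurface_four_le_mu_of_double_successor`,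
p501990). [folklore] -/
theorem hypersurface_exists_double_successor_iff_four_le_mu [CharP κ 2] (hn : 3 ≤ n)
    (c : (Fin n → ℕ) → κ) (hM : MultP 2 n κ c) (hI : Isol 2 n κ c) (he : milnorEmbDim 2 n κ c = 1) :
    (∃ (i : Fin n) (τ : Fin n → κ), MultP 2 n κ (step 2 n κ i τ c)) ↔ 4 ≤ mu 2 n κ c :=
  ⟨fun ⟨i, τ, h⟩ => (hypersurface_four_le_mu_of_double_successor c i τ hM hI (by omega) h).2.2,
    hypersurface_exists_double_successor hn c hM hI he⟩

/-- [OURS · L1 W4.6 rung (ii) at `p = 2`, every dimension; NOT a statement of the manuscript]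
**RESOLVED BY ONE BLOW-UP IFF `μ = 2`** (`e = 1`, `n ≥ 3`, any field of characteristic `2`): an
isolated double state with curvilinear Milnor algebra has NO double point among its successors (every
chart and translation give a smooth point or order `< 2`) iff its Milnor number is `2` (`μ` is even and
`≥ 2`). [folklore] -/
theorem hypersurface_resolved_in_one_iff_mu_eq_two [CharP κ 2] (hn : 3 ≤ n) (c : (Fin n → ℕ) → κ)
    (hM : MultP 2 n κ c) (hI : Isol 2 n κ c) (he : milnorEmbDim 2 n κ c = 1) :
    (∀ (i : Fin n) (τ : Fin n → κ), ¬ MultP 2 n κ (step 2 n κ i τ c)) ↔ mu 2 n κ c = 2 := by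
  obtain ⟨hev, h2, -⟩ := curvilinear_of_milnorEmbDim_eq_one hM hI he
  have h := hypersurface_exists_double_successor_iff_four_le_mu hn c hM hI he
  constructor
  · intro hno
    by_contra hne
    obtain ⟨k, hk⟩ := hev
    obtain ⟨i, τ, hiτ⟩ := h.mpr (by omega)
    exact hno i τ hiτ
  · rintro hμ i τ hiτ
    have := h.mp ⟨i, τ, hiτ⟩
    omega

end CampaignW46.HypersurfacesCharTwo

end Summit.ResolutionOfSingularities.ResolutionOfSingularities.Theorems

end
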